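/- Copyright: the b2b-balaban cell (near-miss cell 7), T⁴-continuum fan-out, NE7b crux-team leaf lineage
`t4-ne7b-formalise-leaf-02` (gen 112) — (α)-instance, THE END AT THE TOWER AT PRINT's ROUNDED RENEWAL LETTER, part 3R
ON THE PERFORMED RANGE: the OWNER's part 3R (`B16HistoryTowerEndPrintedR`, R-ne7bp1-g101-5, p348241) composed with J4.2
(`B16HistoryStepJunctionRange`, p347669) instead of J4 — the «3R twin over J4.2» the OWNER invited (CLAIMS.log l.48674).  Offered
as O-leaf02-g112-1 (CLAIMS.log l.48917, bytes ff05cae30e0b26a5); FILED by the leaf under the row OWNER `t4-ne7b-p1`'s word «OFFER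
O-leaf02-g112-1 «3R-range» `Support/B16HistoryTowerEndPrintedRRange.lean` ff05cae30e0b26a5: (a) GO TO FILE» (INBOX [NE7bP1-G101-
INBOX-CLOSE] L.42762, CLAIMS.log [NE7bP1-G101-CLOSE] l.49019 — the named-interface exception of FREEZE (0)); v1.1 = v1 with this header
comment only, every byte from the `import` lines on identical.  Released under the licence of the surrounding project. -/
import Summits.QuantumFields.BalabanUV.T4Continuum.Support.B16HistoryTowerEndPrintedR
import Summits.QuantumFields.BalabanUV.T4Continuum.Support.B16HistoryStepJunctionRange

/-!
# (α)-INSTANCE — THE END AT THE ROUNDED RENEWAL LETTER, part 3R ON THE PERFORMED RANGE `j < K`: `TowerReadDataLWR.hw` FROM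
[B16] pp. 380–383's PER-STEP SENTENCES ASKED ONLY FOR THE PERFORMED OPERATIONS, (A)'s CONVENTION (β) PAST THE CUTOFF, AND
p. 380's VOLUME CHAIN FROM A CUBE COUNT — ON THE NOSE (no `hsRdom`, no letter moved)

Summits-side support leaf of the T⁴-continuum cell (rung (B)+1 on a FINITE torus only; NOT infinite volume, NOT the mass gap,
NOT Clay; NOT a proof of NE7b — the cell's OWN estimate `T4WeightBudget.RelWeightBound`, NOT PRINTED, NOT PROVED).  [folklore]
three instances of J4.2 (`B16HistoryStepJunctionRange`) at the rounded record's letters through part 3R's letter table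
`B16HistoryTowerEndPrintedR.sRrnd_eq_sRsharp`; no `Prop` minted, nothing cited as hypothesis, zero `sorry`.

WHY.  Part 3R (`hw_of_stepDisplays_rounded(_of_hvol ∕ _le)`) fills the rounded record's slot
`TowerReadDataLWR.hw : HwPinned T 𝒮 sB (sRrnd D O p₁ g₀ 𝒮.R) cΛ M (gsOf D g₀) K₀` from J4, whose displays `hdisp` ∕ `hclass` ∕
`hvol` (or `hchain`) are asked at EVERY step index `j : ℕ` of every run `K ≥ K₀`.  The printed claim they are fed from,
`B16StepFactorsPrinted.StepFactorsPrinted`, speaks only for the performed operations `j < P.K` (refuter ν-3b-range-1, PRICING-NE7b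
v54 F303), and (A)'s docstring fixes the convention (β) «`op j g p := 0` past the cutoff».  J4.2 is J4 in that shape; this file
is part 3R in that shape: the same three theorems with every display of Bałaban's kind restricted to `j < K`, plus (β) as ONE
tower-side display `hβ : K ≤ j → ((T K).op j g p).T 1 x = 0`, and — third form — the volume side from the four primitive inputs
the OWNER named (journal l.48029): print's `|Z ∩ Ω| ≤ |Z|` (`hΩ`), a cube-count reading of `|Z_{j+1}|` (`hcube`), `0 ≤ C′`,
`0 ≤ C380`, `C′ + C380 ≤ cΛ`, and `1 ≤ ℓ_{j+1}` on the performed range.  The letter step is part 3R's, verbatim: J4.2's output at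
`B16HistoryStepJunction.sRsharp (runsOf D g₀) c` is moved to `sRrnd D O p₁ g₀ 𝒮.R` by `HwPinned.of_le` at `le_of_eq` of the table
`sRrnd_eq_sRsharp` (`c.d = O.d`, `c.R (g^K_h) = R_h`, `c.P1 (g^K_h) = ℓ_h^{p₁}`) — an EQUALITY, so nothing is weakened or
strengthened; the coupling sequences `fun K => (runsOf D g₀ K).flow.g` ARE `gsOf D g₀` (`flow_runsOf`, `rfl`).

WHAT IS PROVED (ns `Summit.QuantumFields.BalabanUV.T4Continuum.B16HistoryTowerEndPrintedRRange`).
* `hw_of_stepDisplays_rounded_of_hvol_range` — part 3R's core form with `hβ` and `hdisp` ∕ `hclass` ∕ `hvol` on `j < K`.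
* `hw_of_stepDisplays_rounded_le_range` — the same with the class junction in its `≤` form (`hclassle`, print's sign `0 ≤ γ₀`).
* `hw_of_stepDisplays_rounded_cubeCount_range` — `hβ`; `hdisp`, `hclass`, `hΩ`, `hcube` on `j < K`; `0 ≤ C′`, `0 ≤ C380`,
  `C′ + C380 ≤ cΛ`, `0 ≤ M`; `0 ≤ ℓ_j` (`j ≤ K`) and `1 ≤ ℓ_{j+1}` (`j < K`, `K ≥ K₀`); the three table rows ⟹
  `HwPinned T 𝒮 (sBsharp (runsOf D g₀) c) (sRrnd D O p₁ g₀ 𝒮.R) cΛ M (gsOf D g₀) K₀` — THE TYPE OF `TowerReadDataLWR.hw` at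
  `sB := sBsharp (runsOf D g₀) c`, with NO chain, NO `hvol` and NO renewal-letter inequality displayed.

NOT HERE (honest).  Which `T`, `𝒮`, `Xs`, `D` are Bałaban's and the inhabitation of `hβ` ∕ `hdisp` ∕ `hclass` ∕ `hΩ` ∕ `hcube` for
them ((A1c) DATA, NC-NE7b-α); `StepFactorsPrinted` for his construction; any valuation; M5; the other fields of `TowerReadDataLWR`.
BY-NAME EFFECT ON THE WALL (`WALL-NE7b-P1.md` §2): NONE by this file alone.  HONEST DEPENDENCY (cell): continuum YM on T⁴ ⇐
BetaPertH ∧ nine spine estimates (0/9 proved); BetaPertH ⇐ (D1) ∧ (D4) ∧ CAP+tail; G-an2-4 gates asym, D1 and NE2/3/4.  This file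
changes none of it. -/

open Finset MeasureTheory
open Literature.MathematicalPhysics.QuantumFieldTheory.Balaban1983to89
open Literature.MathematicalPhysics.QuantumFieldTheory.Balaban1983to89.B16StepFactorsPrinted
open T4PrintedShapeBanking T4Continuum
open Summit.QuantumFields.BalabanUV.T4Continuum.HistoryConstants
open Summit.QuantumFields.BalabanUV.T4Continuum.HistoryGenealogyExtraction
open Summit.QuantumFields.BalabanUV.T4Continuum.HistoryGenealogyRealise
open Summit.QuantumFields.BalabanUV.T4Continuum.HistoryGenealogyInstantiate
open Summit.QuantumFields.BalabanUV.T4Continuum.B16HistoryIndexedRepr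
open Summit.QuantumFields.BalabanUV.T4Continuum.B16HistoryReprChain
open Summit.QuantumFields.BalabanUV.T4Continuum.B16HistoryReprInstance
open Summit.QuantumFields.BalabanUV.T4Continuum.B16HistoryReprReadCausal
open Summit.QuantumFields.BalabanUV.T4Continuum.B16HistoryStepDisplayPinned
open Summit.QuantumFields.BalabanUV.T4Continuum.B16HistoryStepJunction
open Summit.QuantumFields.BalabanUV.T4Continuum.B16HistoryStepJunctionRange
open Summit.QuantumFields.BalabanUV.T4Continuum.B16HistoryTowerEndDataLWL
open Summit.QuantumFields.BalabanUV.T4Continuum.B16HistoryTowerEndDataLWR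
open Summit.QuantumFields.BalabanUV.T4Continuum.B16HistoryTowerEndPrinted (runsOf flow_runsOf)
open Summit.QuantumFields.BalabanUV.T4Continuum.B16HistoryTowerEndPrintedR (sRrnd_eq_sRsharp)
open Summit.QuantumFields.BalabanUV.T4Continuum.HistoryBankingSharpShares (ell)
open Summit.QuantumFields.BalabanUV.T4Continuum.HistoryBankingVolumeWindowLattice (uvolL)

namespace Summit.QuantumFields.BalabanUV.T4Continuum.B16HistoryTowerEndPrintedRRange

noncomputable section

section Range

variable {F : T4Family} {G : Type*} [GaugeGroup G] [MeasurableSpace G] [HaarData G]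
  (D : FiniteEpsData F G) (O : PrintedO1s) (p₁ : ℕ) (g₀ : ℕ → ℝ)
  {P : Type} {d : ℕ} {X : ℕ → ℕ → Type} {𝒢 : (K j : ℕ) → GoodClass (X K j)}
  (T : (K : ℕ) → Tower P (X K) (𝒢 K)) (𝒮 : StepReading P d) (c : B16StepFactorsPrinted.Consts)
  (Xs : (K j : ℕ) → (Fin j → P) → StepData d P) (cΛ M : ℝ)

/-- **PART 1R's `hw` SLOT FROM J4.2, CORE FORM ON THE PERFORMED RANGE** (volume side displayed as `hvol`): (A)'s convention (β)
as ONE tower-side display `hβ` («the step map past the cutoff kills the unit»), print's per-step sentences `hdisp`, the `=` class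
junction `hclass` and the volume domination `hvol` asked ONLY for the performed operations `j < K` of the runs `K ≥ K₀`, and the
renewal letter table (`hd`, `hR`, `hP`) give `HwPinned T 𝒮 (sBsharp (runsOf D g₀) c) (sRrnd D O p₁ g₀ 𝒮.R) cΛ M (gsOf D g₀) K₀` —
THE TYPE OF `TowerReadDataLWR.hw` at `sB := sBsharp (runsOf D g₀) c`.  `= (hwPinned_of_stepDisplaysAt_range …).of_le le_rfl
(le_of_eq table) le_rfl` — no letter moves; past the cutoff `0 ≤ wStep`. [folklore] -/
theorem hw_of_stepDisplays_rounded_of_hvol_range {K₀ : ℕ} (hc : 0 ≤ cΛ) (hM : 0 ≤ M)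
    (hℓ : ∀ K j, j ≤ K → 0 ≤ ell (gsOf D g₀ K) j)
    (hβ : ∀ K, K₀ ≤ K → ∀ j, K ≤ j → ∀ (g : Fin j → P) (p : P) (x : X K (j + 1)),
      ((T K).op j g p).T (fun _ => 1) x = 0)
    (hdisp : ∀ K, K₀ ≤ K → ∀ j, j < K → ∀ (g : Fin j → P),
      StepDisplaysAt (runsOf D g₀ K) j (carriersOf T 𝒮 (runsOf D g₀ K) K j g (Xs K j g)) c)
    (hclass : ∀ K, K₀ ≤ K → ∀ j, j < K → ∀ (g : Fin j → P) (p : P),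
      ∀ x ∈ (𝒮.runPartial K (j + 1) (Fin.snoc g p)).histM.newPairs (j + 1),
        (Xs K j g).dC p x = (𝒮.κ K ((𝒮.runPartial K (j + 1) (Fin.snoc g p)).histM.newAt (j + 1) x) : ℝ))
    (hvol : ∀ K, K₀ ≤ K → ∀ j, j < K → ∀ (g : Fin j → P) (p : P),
      (Xs K j g).gInt p * (Xs K j g).aInt p * (Xs K j g).vfac p ≤
        ∏ cc ∈ (𝒮.runPartial K (j + 1) (Fin.snoc g p)).histM.comp (j + 1),
          ΛexpL cΛ M d (gsOf D g₀) 𝒮.R K (j + 1) ^ (cc.2).card)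
    (hd : c.d = O.d) (hR : ∀ K h, c.R (gsOf D g₀ K h) = (𝒮.R K h : ℝ))
    (hP : ∀ K h, c.P1 (gsOf D g₀ K h) = ell (gsOf D g₀ K) h ^ p₁) :
    HwPinned T 𝒮 (sBsharp (runsOf D g₀) c) (sRrnd D O p₁ g₀ 𝒮.R) cΛ M (gsOf D g₀) K₀ :=
  (hwPinned_of_stepDisplaysAt_range T 𝒮 (runsOf D g₀) c Xs cΛ M (gsOf D g₀) hc hM hℓ hβ hdisp hclass hvol).of_le
    (fun _ _ _ => le_rfl) (fun K h => (sRrnd_eq_sRsharp D O p₁ g₀ 𝒮.R c hd hR hP K h).le) le_rfl hM hℓ hc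

/-- **… ON THE PERFORMED RANGE WITH THE CLASS JUNCTION IN ITS `≤` FORM** (`hclassle` on `j < K`; needs print's sign `0 ≤ γ₀`),
the volume side as `hvol`. [folklore] -/
theorem hw_of_stepDisplays_rounded_le_range {K₀ : ℕ} (hc : 0 ≤ cΛ) (hM : 0 ≤ M)
    (hℓ : ∀ K j, j ≤ K → 0 ≤ ell (gsOf D g₀ K) j) (hγ : 0 ≤ c.γ₀)
    (hβ : ∀ K, K₀ ≤ K → ∀ j, K ≤ j → ∀ (g : Fin j → P) (p : P) (x : X K (j + 1)),
      ((T K).op j g p).T (fun _ => 1) x = 0)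
    (hdisp : ∀ K, K₀ ≤ K → ∀ j, j < K → ∀ (g : Fin j → P),
      StepDisplaysAt (runsOf D g₀ K) j (carriersOf T 𝒮 (runsOf D g₀ K) K j g (Xs K j g)) c)
    (hclassle : ∀ K, K₀ ≤ K → ∀ j, j < K → ∀ (g : Fin j → P) (p : P),
      ∀ x ∈ (𝒮.runPartial K (j + 1) (Fin.snoc g p)).histM.newPairs (j + 1),
        (𝒮.κ K ((𝒮.runPartial K (j + 1) (Fin.snoc g p)).histM.newAt (j + 1) x) : ℝ) ≤ (Xs K j g).dC p x)
    (hvol : ∀ K, K₀ ≤ K → ∀ j, j < K → ∀ (g : Fin j → P) (p : P),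
      (Xs K j g).gInt p * (Xs K j g).aInt p * (Xs K j g).vfac p ≤
        ∏ cc ∈ (𝒮.runPartial K (j + 1) (Fin.snoc g p)).histM.comp (j + 1),
          ΛexpL cΛ M d (gsOf D g₀) 𝒮.R K (j + 1) ^ (cc.2).card)
    (hd : c.d = O.d) (hR : ∀ K h, c.R (gsOf D g₀ K h) = (𝒮.R K h : ℝ))
    (hP : ∀ K h, c.P1 (gsOf D g₀ K h) = ell (gsOf D g₀ K) h ^ p₁) :
    HwPinned T 𝒮 (sBsharp (runsOf D g₀) c) (sRrnd D O p₁ g₀ 𝒮.R) cΛ M (gsOf D g₀) K₀ :=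
  (hwPinned_of_stepDisplaysAt_le_range T 𝒮 (runsOf D g₀) c Xs cΛ M (gsOf D g₀) hc hM hℓ hγ hβ hdisp hclassle hvol).of_le
    (fun _ _ _ => le_rfl) (fun K h => (sRrnd_eq_sRsharp D O p₁ g₀ 𝒮.R c hd hR hP K h).le) le_rfl hM hℓ hc

/-- **PART 1R's `hw` SLOT FROM J4.2 WITH EVERY VOLUME INPUT PRIMITIVE, ON THE PERFORMED RANGE** (class junction `=`): `hβ`; `hdisp`,
`hclass`, print's `|Z ∩ Ω| ≤ |Z|` (`hΩ`) and the cube-count reading `|Z_{j+1}| ≤ (M·R_{j+1})^d · Σ_cc #cc.2` (`hcube`), each ONLY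
for `j < K`; the constants-side `0 ≤ C′`, `0 ≤ C380`, `C′ + C380 ≤ cΛ`, `0 ≤ M`; the flow-side `0 ≤ ℓ_j` (`j ≤ K`, every run) and
`1 ≤ ℓ_{j+1}` (`j < K`, runs `K ≥ K₀`); the three table rows ⟹ `TowerReadDataLWR.hw`'s type at `sB := sBsharp (runsOf D g₀) c`.
No `hchain`, no `hvol`, no renewal-letter inequality displayed; the coupling sequences of J4.2's output, `fun K =>
(runsOf D g₀ K).flow.g`, ARE `gsOf D g₀` (`flow_runsOf`, `rfl`). [folklore] -/
theorem hw_of_stepDisplays_rounded_cubeCount_range {K₀ : ℕ} (hM : 0 ≤ M) (hC' : 0 ≤ c.C') (hC380 : 0 ≤ c.C380)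
    (hcΛ : c.C' + c.C380 ≤ cΛ) (hℓ : ∀ K j, j ≤ K → 0 ≤ ell (gsOf D g₀ K) j)
    (hℓ1 : ∀ K, K₀ ≤ K → ∀ j, j < K → 1 ≤ ell (gsOf D g₀ K) (j + 1))
    (hβ : ∀ K, K₀ ≤ K → ∀ j, K ≤ j → ∀ (g : Fin j → P) (p : P) (x : X K (j + 1)),
      ((T K).op j g p).T (fun _ => 1) x = 0)
    (hdisp : ∀ K, K₀ ≤ K → ∀ j, j < K → ∀ (g : Fin j → P),
      StepDisplaysAt (runsOf D g₀ K) j (carriersOf T 𝒮 (runsOf D g₀ K) K j g (Xs K j g)) c)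
    (hclass : ∀ K, K₀ ≤ K → ∀ j, j < K → ∀ (g : Fin j → P) (p : P),
      ∀ x ∈ (𝒮.runPartial K (j + 1) (Fin.snoc g p)).histM.newPairs (j + 1),
        (Xs K j g).dC p x = (𝒮.κ K ((𝒮.runPartial K (j + 1) (Fin.snoc g p)).histM.newAt (j + 1) x) : ℝ))
    (hΩ : ∀ K, K₀ ≤ K → ∀ j, j < K → ∀ (g : Fin j → P) (p : P), (Xs K j g).volZΩ p ≤ (Xs K j g).volZ p)
    (hcube : ∀ K, K₀ ≤ K → ∀ j, j < K → ∀ (g : Fin j → P) (p : P),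
      (Xs K j g).volZ p ≤
        (M * 𝒮.R K (j + 1)) ^ d * ∑ cc ∈ (𝒮.runPartial K (j + 1) (Fin.snoc g p)).histM.comp (j + 1), ((cc.2).card : ℝ))
    (hd : c.d = O.d) (hR : ∀ K h, c.R (gsOf D g₀ K h) = (𝒮.R K h : ℝ))
    (hP : ∀ K h, c.P1 (gsOf D g₀ K h) = ell (gsOf D g₀ K) h ^ p₁) :
    HwPinned T 𝒮 (sBsharp (runsOf D g₀) c) (sRrnd D O p₁ g₀ 𝒮.R) cΛ M (gsOf D g₀) K₀ :=
  have hc : 0 ≤ cΛ := (add_nonneg hC' hC380).trans hcΛ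
  (hwPinned_of_stepDisplaysAt_cubeCount_range T 𝒮 (runsOf D g₀) c Xs cΛ M hM hC' hC380 hcΛ hℓ hℓ1 hβ hdisp hclass hΩ
    hcube).of_le
    (fun _ _ _ => le_rfl) (fun K h => (sRrnd_eq_sRsharp D O p₁ g₀ 𝒮.R c hd hR hP K h).le) le_rfl hM hℓ hc

end Range

end

end Summit.QuantumFields.BalabanUV.T4Continuum.B16HistoryTowerEndPrintedRRange
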